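import Summits.QuantumFields.YangMills.Theorems.UnitScaleTiltFluctuationComparisonRegPrRestrictedUpperStep
import Summits.QuantumFields.Balaban3D.Proofs.MassesPAC
import Summits.QuantumFields.Balaban3D.Proofs.TransportDirectAC
import HarnessLib

/-!
# `AlphaInputsT3ACv3Step` — (41) WITH PRINT'S WINDOWED, PINNED WEIGHTS FOR EVERY HISTORY, CONDITIONAL ON THE PROPOSED v3 READING OF THE FIBRE
# RESIDUAL: the lane-generic induction (any scales, any AC inputs) — lane `pub-balaban3d`, seat alpha-1 (crux `HistoryTailL` = stmt-QuantumFields-19936,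
# line v5p4 STUB 2‴ `stub_windowedWeights`; the v3 text proposed 2026-08-27 on the ym-fleet bus)

WHY.  The v2 package's (β) residual `Bound55AC.Fibre49AC` is stated for the lane's FLOORED masses and WITHOUT print's `χ_{k+1}` on the right of
(55); from it only a top-level window at the trivial history with a level-linear integral follows (`AlphaInputsT3ACv2RecWindow{,Ineq}`; seat findings
F-α1-10/11, lead finding F-g3-3, cell ym3-torus FINDING N7).  THE PROPOSED v3 ROW (this file's hypothesis schema `PinnedStep.Fibre55WinAC`): for every new
history `h′` of step `k`,
`T_k[w_k(h′)·χB_k(h′)·(M_k(proj h′)·e^{(41)_k exponent})] ≤ᵐ 𝟙[window_{k+1}(h′)]·M_{k+1}(h′)·e^{(55)·(58) exponent}`,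
with `M` the PINNED exact-transport masses of `MassesPAC` (`M(triv) = 1`) and a window ON THE RIGHT — [Balaban1985UV3] (55) p.269 «(The integral (49)) ≤
χ_{k+1} exp[…]» read for the AC tower; at `h′ = triv` it is the unfactored trivial row of card `unfactored-trivial-row` (no mass, no `T_k 1`).  GIVEN
these rows for `k < K` (plus the lane's nine residual leaves and the data rows `hU`/`hPm`/`hPb`, all delivered by the v2 rows), THIS FILE proves by
induction on the level, `dV`-a.e. (the a.e. form being propagated through the transport by the `min`-modification, `Carriers.rnTransport_congr_ae`):
`ρ_j ≤ Σ_h wtP_j(h)·e^{(41)_j exponent(h)}` for every `j ≤ K`, where `wtP_0 = 1` and `wtP_{k+1}(h′) = 𝟙[window_{k+1}(h′)]·M_{k+1}(h′)` — weights that are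
`≥ 0`, vanish on inadmissible histories, are supported in their windows POINTWISE, and have `∫ ≤ 1` UNIFORMLY IN THE CUT-OFF.  The T³ reading and the
bundle in v5p4's quantifier order are the sequel `AlphaInputsT3ACv3Ready`.  CONDITIONAL (the v3 row is a hypothesis schema, never asserted); the step
itself is [folklore] measure theory (`TransportDirectAC.transport41_le_sum_ae_direct`) + the exponent bookkeeping `RepAtHeightsAdapter.expo5558_le_expo41_succ`.

References: T. Bałaban, Commun. Math. Phys. 102 (1985) 255–275 [Balaban1985UV3] ((40)–(41) p.266, (47)–(49) pp.267–268, (55) p.269, (58) p.270).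
-/

set_option autoImplicit false

noncomputable section

namespace Summit.QuantumFields.YangMills.Theorems.PinnedStep

open MeasureTheory
open Literature.MathematicalPhysics.QuantumFieldTheory.Balaban1983to89
open Literature.MathematicalPhysics.QuantumFieldTheory.Balaban1983to89.AveragingRT (rnTransport rnTransport_nonneg)
open Literature.MathematicalPhysics.QuantumFieldTheory.Balaban1983to89.B10 (Ineq41)
open Literature.MathematicalPhysics.QuantumFieldTheory.Balaban1985CMP102
open Literature.MathematicalPhysics.QuantumFieldTheory.Balaban1985CMP102.Setting
open Summit.QuantumFields.Balaban3D.Carriers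
open Summit.QuantumFields.Balaban3D.Proofs.Inputs (LaneConsts)
open Summit.QuantumFields.Balaban3D.Proofs.ScalesArithmetic (gk_pos gk_le_one)
open Summit.QuantumFields.Balaban3D.Proofs.TowerAC
open Summit.QuantumFields.Balaban3D.Proofs.StandardAC
open Summit.QuantumFields.Balaban3D.Proofs.InputsAC
open Summit.QuantumFields.Balaban3D.Proofs.Bound55Masses (chiB chiB_nonneg chiB_le_one measurable_chiB measurable_stepWeight)
open Summit.QuantumFields.Balaban3D.Proofs.MassesPAC
open Summit.QuantumFields.Balaban3D.Proofs.TransportAC (integrable_mul_exp_of_le)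
open Summit.QuantumFields.Balaban3D.Proofs.TransportDirectAC (transport41_le_sum_ae_direct)
open Summit.QuantumFields.Balaban3D.Proofs.Transport48 (integrable_weight_mul rnTransport_mono_ae)
open Summit.QuantumFields.Balaban3D.Proofs (Bound55Std.measurable_actionEta Bound55Std.actionEta_nonneg)

variable {L : ℕ} (𝔎 : LaneConsts L) {S : Scales L} {G : Type} [GaugeGroup G] [MeasurableSpace G] [HaarData G]
  {E : Type} [NormedAddCommGroup E] [NormedSpace ℂ E]
  (X : ExternalInputsAC S G) (𝔖 : ∀ k, StepSeries S G E (nblkOf S 𝔎.carrier k) k)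
  (win : (k : ℕ) → Hist S.P (k + 1) → Set (GaugeField S.P (k + 1) G))

/-! ## §1 The pinned masses at the lane's parameters, the windowed weights, the row -/

/-- The PINNED masses at the lane's carrier parameters and the input's averaging (`MassesPAC.massRecP`). [cite: Balaban1985UV3, (41) p.266] -/
abbrev massP (k : ℕ) (h : Hist S.P k) (V : GaugeField S.P k G) : ℝ :=
  massRecP 𝔎.carrier.M₁ (rcolOf S 𝔎.carrier) (eps1Of S 𝔎.carrier) (epsSOf S 𝔎.carrier) X.av k h V

/-- **THE WINDOWED PINNED WEIGHTS**: `wtP_0(h) = 1` ((41)₀ = (1) p.256, no characteristic function), `wtP_{k+1}(h′) = 𝟙[window_{k+1}(h′)]·M_{k+1}(h′)`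
(print's `χ_{k+1}` of (40)–(41) p.266 times the pinned mass). [cite: Balaban1985UV3, (40)–(41) p.266] -/
def wtP : (k : ℕ) → Hist S.P k → GaugeField S.P k G → ℝ
  | 0, _, _ => 1
  | k + 1, h', V => (win k h').indicator (fun _ => (1 : ℝ)) V * massP 𝔎 X (k + 1) h' V

/-- `wtP 0 = 1`. [folklore] -/
theorem wtP_zero (h : Hist S.P 0) (V : GaugeField S.P 0 G) : wtP 𝔎 X win 0 h V = 1 := rfl

/-- `wtP (k+1) h′ V = 𝟙[win k h′](V)·M_{k+1}(h′, V)`. [folklore] -/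
theorem wtP_succ (k : ℕ) (h' : Hist S.P (k + 1)) (V : GaugeField S.P (k + 1) G) :
    wtP 𝔎 X win (k + 1) h' V = (win k h').indicator (fun _ => (1 : ℝ)) V * massP 𝔎 X (k + 1) h' V := rfl

/-- `0 ≤ wtP ≤ M` pointwise. [folklore] -/
theorem wtP_nonneg_le : ∀ (k : ℕ) (h : Hist S.P k) (V : GaugeField S.P k G),
    0 ≤ wtP 𝔎 X win k h V ∧ wtP 𝔎 X win k h V ≤ massP 𝔎 X k h V
  | 0, _, _ => ⟨zero_le_one, le_rfl⟩
  | k + 1, h', V => by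
    have h0 := massRecP_nonneg 𝔎.carrier.M₁ (rcolOf S 𝔎.carrier) (eps1Of S 𝔎.carrier) (epsSOf S 𝔎.carrier) X.av (k + 1) h' V
    have hi0 : 0 ≤ (win k h').indicator (fun _ => (1 : ℝ)) V := Set.indicator_nonneg (fun _ _ => zero_le_one) V
    have hi1 : (win k h').indicator (fun _ => (1 : ℝ)) V ≤ 1 := Set.indicator_le_self' (fun _ _ => zero_le_one) V
    rw [wtP_succ]
    exact ⟨mul_nonneg hi0 h0, by nlinarith⟩

/-- **SUPPORT, POINTWISE**: `wtP (k+1) h′ V ≠ 0 ⇒ V ∈ win k h′` and `h′` admissible. [folklore] -/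
theorem mem_of_wtP_succ_ne_zero (k : ℕ) (h' : Hist S.P (k + 1)) (V : GaugeField S.P (k + 1) G) (hne : wtP 𝔎 X win (k + 1) h' V ≠ 0) :
    V ∈ win k h' ∧ Hist.Admissible 𝔎.carrier.M₁ (rcolOf S 𝔎.carrier) (k + 1) h' := by
  rw [wtP_succ] at hne
  refine ⟨by_contra fun hV => hne (by rw [Set.indicator_of_notMem hV, zero_mul]), by_contra fun hh => hne ?_⟩
  have h0 : massP 𝔎 X (k + 1) h' V = 0 := massRecP_eq_zero_of_not_admissible _ _ _ _ _ (k + 1) h' V hh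
  rw [h0, mul_zero]

/-- `wtP` vanishes on inadmissible histories, pointwise. [folklore] -/
theorem wtP_eq_zero_of_not_admissible : ∀ (k : ℕ) (h : Hist S.P k) (V : GaugeField S.P k G),
    ¬ Hist.Admissible 𝔎.carrier.M₁ (rcolOf S 𝔎.carrier) k h → wtP 𝔎 X win k h V = 0
  | 0, _, _, hh => absurd trivial hh
  | k + 1, h', V, hh => by
    have h0 : massP 𝔎 X (k + 1) h' V = 0 := massRecP_eq_zero_of_not_admissible _ _ _ _ _ (k + 1) h' V hh
    rw [wtP_succ, h0, mul_zero]

/-- `wtP` is measurable (`win` measurable). [folklore] -/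
theorem measurable_wtP (hwin : ∀ k h', MeasurableSet (win k h')) : ∀ (k : ℕ) (h : Hist S.P k), Measurable (wtP 𝔎 X win k h)
  | 0, _ => measurable_const
  | k + 1, h' => ((measurable_const.indicator (hwin k h')).mul (measurable_massRecP _ _ _ _ _ (k + 1) h') :
      Measurable fun V => (win k h').indicator (fun _ => (1 : ℝ)) V * massP 𝔎 X (k + 1) h' V)

variable [RegularGaugeGroup G]

/-- `wtP` is integrable with **`∫ wtP k h ≤ 1` uniformly in the level** (`MassesPAC.integral_massRecP_le_one`). [folklore] -/
theorem integrable_wtP_and_integral_le (hwin : ∀ k h', MeasurableSet (win k h')) (k : ℕ) (h : Hist S.P k) :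
    Integrable (wtP 𝔎 X win k h) (fieldMeasure S.P k G) ∧ ∫ V, wtP 𝔎 X win k h V ∂(fieldMeasure S.P k G) ≤ 1 := by
  have hm := integrable_massRecP 𝔎.carrier.M₁ (rcolOf S 𝔎.carrier) (eps1Of S 𝔎.carrier) (epsSOf S 𝔎.carrier) X.av k h
  have hint : Integrable (wtP 𝔎 X win k h) (fieldMeasure S.P k G) :=
    hm.mono' (measurable_wtP 𝔎 X win hwin k h).aestronglyMeasurable (ae_of_all _ fun V => by
      rw [Real.norm_eq_abs, abs_of_nonneg (wtP_nonneg_le 𝔎 X win k h V).1]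
      exact (wtP_nonneg_le 𝔎 X win k h V).2)
  exact ⟨hint, (integral_mono hint hm fun V => (wtP_nonneg_le 𝔎 X win k h V).2).trans
    (integral_massRecP_le_one _ _ _ _ _ X.av_ac k h)⟩

omit [RegularGaugeGroup G] in
/-- **THE PROPOSED v3 RESIDUAL ROW `Fibre55Win` AT STEP `k`, NEW HISTORY `h′`** (hypothesis schema, never asserted): «The integral (49)» for `h′` — the
transport of `w_k(h′)·χB_k(h′)·wtP_k(proj h′)·e^{(41)_k exponent at proj h′}` — is `dV`-a.e. below `𝟙[window_{k+1}(h′)]·M_{k+1}(h′)·e^{(55)·(58) exponent at h′}`,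
with `M` the PINNED masses and `wtP_k = 𝟙[window_k]·M_k` (`wtP_0 = 1`) the WINDOWED pinned weights — print's `χ_k` window of (49) p.268 on the LEFT
(R-g18-a, cell ym3-torus finding N-g18-2: with the bare `M_k(triv) = 1` on the left the row would ask the (41)_k main-term bound off the small-field window at the
trivial history, stronger than print) and print's `χ_{k+1}` window on the RIGHT — [Balaban1985UV3] (55) p.269 «(The integral (49)) ≤ χ_{k+1} exp[−(1/g_k²)A^η(U_{k+1})
− E_k + …]» with (58) p.270, read for the AC tower.  A (β) ρ-display ASSUMED (status: proposed RESIDUAL of a v3 package; replaces the v2 row `Fibre49AC`, which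
is the same display for the floored masses without the windows). [cite: Balaban1985UV3, (49)–(55) pp.268–269 + (58) p.270] -/
def Fibre55WinAC (k : ℕ) (h' : Hist S.P (k + 1)) : Prop :=
  (rnTransport (X.av k).avg (fun U =>
      stepWeight 𝔎.carrier.M₁ (rcolOf S 𝔎.carrier) (eps1Of S 𝔎.carrier) (epsSOf S 𝔎.carrier) k h' U *
        chiB 𝔎.carrier.M₁ (rcolOf S 𝔎.carrier) (eps1Of S 𝔎.carrier) k h' U *
        (wtP 𝔎 X win k h'.proj U *
          Real.exp (-((towerOfAC 𝔎 X 𝔖).mainT k h'.proj U) + (towerOfAC 𝔎 X 𝔖).Pint k h'.proj U - (towerOfAC 𝔎 X 𝔖).Ecst k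
            + (towerOfAC 𝔎 X 𝔖).Zterm k h'.proj + (towerOfAC 𝔎 X 𝔖).Rm k))))
    ≤ᵐ[fieldMeasure S.P (k + 1) G] fun V =>
      (win k h').indicator (fun _ => (1 : ℝ)) V * massP 𝔎 X (k + 1) h' V *
        Real.exp (-((towerOfAC 𝔎 X 𝔖).mainT (k + 1) h' V) - (towerOfAC 𝔎 X 𝔖).Ecst k
          + ((piecesAC 𝔎 X 𝔖 k).logσ₀ + (piecesAC 𝔎 X 𝔖 k).dg * Real.log ((towerOfAC 𝔎 X 𝔖).g k)) * (piecesAC 𝔎 X 𝔖 k).starB h'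
          + (piecesAC 𝔎 X 𝔖 k).logZU h' V + (piecesAC 𝔎 X 𝔖 k).Pold h' V
          + (towerOfAC 𝔎 X 𝔖).Zterm k ((piecesAC 𝔎 X 𝔖 k).proj h') + (towerOfAC 𝔎 X 𝔖).Rm k + (piecesAC 𝔎 X 𝔖 k).logFl h' V)

/-! ## §2 Integrability of the weighted (41)-summands from the data rows -/

/-- An integrable weight times `exp` of the (41)_k exponent at `h` is integrable, given the data rows at level `k` (`U_k(·,h)` measurable, `Pint_k(h,·)`
measurable and `≤ cP`; `mainT ≥ 0` measurable). [folklore] -/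
theorem integrable_mul_exp41 (k : ℕ) (hU : ∀ h : Hist S.P k, Measurable (X.UkH k h))
    (hPm : ∀ h : Hist S.P k, Measurable ((inputOfAC 𝔎 X 𝔖).Pint k h)) (cP : ℝ)
    (hPb : ∀ (h : Hist S.P k) (U : GaugeField S.P k G), (inputOfAC 𝔎 X 𝔖).Pint k h U ≤ cP)
    (h : Hist S.P k) {m : GaugeField S.P k G → ℝ} (hm : Integrable m (fieldMeasure S.P k G)) :
    Integrable (fun U => m U * Real.exp (-((towerOfAC 𝔎 X 𝔖).mainT k h U) + (towerOfAC 𝔎 X 𝔖).Pint k h U - (towerOfAC 𝔎 X 𝔖).Ecst k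
      + (towerOfAC 𝔎 X 𝔖).Zterm k h + (towerOfAC 𝔎 X 𝔖).Rm k)) (fieldMeasure S.P k G) := by
  have hmain : ∀ U, (towerOfAC 𝔎 X 𝔖).mainT k h U = (S.gk k)⁻¹ ^ 2 * S.actionEta k (X.UkH k h U) := fun _ => rfl
  refine integrable_mul_exp_of_le hm ?_ (c := cP - (towerOfAC 𝔎 X 𝔖).Ecst k + (towerOfAC 𝔎 X 𝔖).Zterm k h + (towerOfAC 𝔎 X 𝔖).Rm k) ?_
  · simp_rw [hmain]
    exact ((((measurable_const.mul ((Bound55Std.measurable_actionEta (S := S) k).comp (hU h))).neg.add (hPm h)).sub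
      measurable_const).add measurable_const).add measurable_const
  · intro U
    have h0 : 0 ≤ (towerOfAC 𝔎 X 𝔖).mainT k h U := by rw [hmain]; exact mul_nonneg (sq_nonneg _) (Bound55Std.actionEta_nonneg (S := S) k _)
    have h1 : (towerOfAC 𝔎 X 𝔖).Pint k h U ≤ cP := hPb h U
    linarith

/-! ## §3 The induction: (41) with the windowed pinned weights, `dV`-a.e., every level `j ≤ K` -/

/-- **(41) WITH PRINT'S WINDOWED PINNED WEIGHTS, `dV`-A.E., AT EVERY LEVEL `j ≤ K`, GIVEN THE v3 ROWS** — for the lane's AC tower over ANY scales and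
AC inputs: if the proposed residual rows `Fibre55WinAC` hold at every step `k < K` for every new history, the nine residual step leaves hold (`R`, from
the (α) step rows by `Thm2AC.stepResidualsAC_of_alpha`), and the data rows `hU`/`hPm`/`hPb` hold at every `k < K`, then for every `j ≤ K`,
`ρ_j(V) ≤ Σ_h wtP_j(h, V)·exp(−mainT_j(h,V) + Pint_j(h,V) − E_j + Zterm_j(h) + Rm_j)` for `dV`-a.e. `V`.  Induction on `j`: (41)₀ is the lane's
(`Thm2AC.step0_towerOfAC`, all weights `1`); the step transports `min(ρ_j, majorant_j)` (`= ρ_j` a.e. by the induction hypothesis,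
`Carriers.rnTransport_congr_ae`) by the DIRECT (48)–(49) step (`TransportDirectAC.transport41_le_sum_ae_direct`) whose fibre hypothesis is the row
VERBATIM, then the per-history exponent bookkeeping
(`RepAtHeightsAdapter.expo5558_le_expo41_succ` on `Thm2AC.stepLeavesOfAC`) and the honesty of the version selection (`Carriers.run3_rho_succ_ae_eq_rn`).
[cite: Balaban1985UV3, (41) p.266 + (48)–(49) pp.267–268 + (55) p.269] -/
theorem ineq41_pinned_windowed_ae (hwin : ∀ k h', MeasurableSet (win k h'))
    (hrow : ∀ k, k + 1 ≤ S.K → ∀ h' : Hist S.P (k + 1), Fibre55WinAC 𝔎 X 𝔖 win k h')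
    (R : ∀ k, k + 1 ≤ S.K → Summit.QuantumFields.Balaban3D.Proofs.Thm2AC.StepResidualsAC 𝔎 X 𝔖 k)
    (hU : ∀ k, k + 1 ≤ S.K → ∀ h : Hist S.P k, Measurable (X.UkH k h))
    (hPm : ∀ k, k + 1 ≤ S.K → ∀ h : Hist S.P k, Measurable ((inputOfAC 𝔎 X 𝔖).Pint k h))
    (hPb : ∀ k, k + 1 ≤ S.K → ∃ cP : ℝ, ∀ (h : Hist S.P k) (U : GaugeField S.P k G), (inputOfAC 𝔎 X 𝔖).Pint k h U ≤ cP) :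
    ∀ j : ℕ, j ≤ S.K → ∀ᵐ V ∂(fieldMeasure S.P j G), (towerOfAC 𝔎 X 𝔖).ρ j V ≤
      ∑ h : Hist S.P j, wtP 𝔎 X win j h V *
        Real.exp (-((towerOfAC 𝔎 X 𝔖).mainT j h V) + (towerOfAC 𝔎 X 𝔖).Pint j h V - (towerOfAC 𝔎 X 𝔖).Ecst j
          + (towerOfAC 𝔎 X 𝔖).Zterm j h + (towerOfAC 𝔎 X 𝔖).Rm j) := by
  classical
  intro j
  induction j with
  | zero =>
    intro _
    exact ae_of_all _ fun V => (Summit.QuantumFields.Balaban3D.Proofs.Thm2AC.step0_towerOfAC 𝔎 X 𝔖).1 V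
  | succ j ih =>
    intro hj
    have ihj := ih (by omega)
    obtain ⟨cP, hcP⟩ := hPb j hj
    have hLS := Summit.QuantumFields.Balaban3D.Proofs.AlphaBound55.eps1Of_le_epsSOf j 𝔎.carrier 𝔎.F.b₀_nonneg 𝔎.F.p₀_pos.le
      (show j ≤ S.K by omega)
    -- integrability of the level-`j` summands, for the weights `wtP` and for the masses `M`
    have hintW : ∀ h : Hist S.P j, Integrable (fun U => wtP 𝔎 X win j h U * Real.exp (-((towerOfAC 𝔎 X 𝔖).mainT j h U) + (towerOfAC 𝔎 X 𝔖).Pint j h U - (towerOfAC 𝔎 X 𝔖).Ecst j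
            + (towerOfAC 𝔎 X 𝔖).Zterm j h + (towerOfAC 𝔎 X 𝔖).Rm j)) (fieldMeasure S.P j G) :=
      fun h => integrable_mul_exp41 𝔎 X 𝔖 j (hU j hj) (hPm j hj) cP hcP h (integrable_wtP_and_integral_le 𝔎 X win hwin j h).1
    have hMaj_int : Integrable (fun U => ∑ h : Hist S.P j, wtP 𝔎 X win j h U * Real.exp (-((towerOfAC 𝔎 X 𝔖).mainT j h U) + (towerOfAC 𝔎 X 𝔖).Pint j h U - (towerOfAC 𝔎 X 𝔖).Ecst j
            + (towerOfAC 𝔎 X 𝔖).Zterm j h + (towerOfAC 𝔎 X 𝔖).Rm j)) (fieldMeasure S.P j G) := integrable_finsetSum _ fun h _ => hintW h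
    have hMaj0 : ∀ U, 0 ≤ (fun U => ∑ h : Hist S.P j, wtP 𝔎 X win j h U * Real.exp (-((towerOfAC 𝔎 X 𝔖).mainT j h U) + (towerOfAC 𝔎 X 𝔖).Pint j h U - (towerOfAC 𝔎 X 𝔖).Ecst j
            + (towerOfAC 𝔎 X 𝔖).Zterm j h + (towerOfAC 𝔎 X 𝔖).Rm j)) U := fun U =>
      Finset.sum_nonneg fun h _ => mul_nonneg (wtP_nonneg_le 𝔎 X win j h U).1 (Real.exp_pos _).le
    -- the a.e.-modified density `min ρ_j Maj`
    have hpin : (towerOfAC 𝔎 X 𝔖).ρ j = (towerWAC 𝔎 X 𝔖).rho j := (towerWAC 𝔎 X 𝔖).pin_rho j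
    have hρ0 : ∀ U, 0 ≤ (towerOfAC 𝔎 X 𝔖).ρ j U := fun U => by
      rw [hpin]; exact run3_rho_nonneg ((inputOfAC 𝔎 X 𝔖).toRunInput fun _ => True) j U
    have hρi : Integrable ((towerOfAC 𝔎 X 𝔖).ρ j) (fieldMeasure S.P j G) := by
      rw [hpin]; exact run3_rho_integrable ((inputOfAC 𝔎 X 𝔖).toRunInput fun _ => True) j
    have hρt0 : ∀ U, 0 ≤ (fun U => min ((towerOfAC 𝔎 X 𝔖).ρ j U) ((fun U => ∑ h : Hist S.P j, wtP 𝔎 X win j h U * Real.exp (-((towerOfAC 𝔎 X 𝔖).mainT j h U) + (towerOfAC 𝔎 X 𝔖).Pint j h U - (towerOfAC 𝔎 X 𝔖).Ecst j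
            + (towerOfAC 𝔎 X 𝔖).Zterm j h + (towerOfAC 𝔎 X 𝔖).Rm j)) U)) U := fun U => le_min (hρ0 U) (hMaj0 U)
    have hρt_ae : (towerOfAC 𝔎 X 𝔖).ρ j =ᵐ[fieldMeasure S.P j G] (fun U => min ((towerOfAC 𝔎 X 𝔖).ρ j U) ((fun U => ∑ h : Hist S.P j, wtP 𝔎 X win j h U * Real.exp (-((towerOfAC 𝔎 X 𝔖).mainT j h U) + (towerOfAC 𝔎 X 𝔖).Pint j h U - (towerOfAC 𝔎 X 𝔖).Ecst j
            + (towerOfAC 𝔎 X 𝔖).Zterm j h + (towerOfAC 𝔎 X 𝔖).Rm j)) U)) := by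
      filter_upwards [ihj] with U hU
      exact (min_eq_left hU).symm
    have hρti : Integrable (fun U => min ((towerOfAC 𝔎 X 𝔖).ρ j U) ((fun U => ∑ h : Hist S.P j, wtP 𝔎 X win j h U * Real.exp (-((towerOfAC 𝔎 X 𝔖).mainT j h U) + (towerOfAC 𝔎 X 𝔖).Pint j h U - (towerOfAC 𝔎 X 𝔖).Ecst j
            + (towerOfAC 𝔎 X 𝔖).Zterm j h + (towerOfAC 𝔎 X 𝔖).Rm j)) U)) (fieldMeasure S.P j G) := hρi.congr hρt_ae
    -- the DIRECT (48)–(49) step for the modified density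
    have hdirect : ∀ h' : Hist S.P (j + 1),
        (rnTransport (X.av j).avg (fun U =>
          stepWeight 𝔎.carrier.M₁ (rcolOf S 𝔎.carrier) (eps1Of S 𝔎.carrier) (epsSOf S 𝔎.carrier) j h' U *
            chiB 𝔎.carrier.M₁ (rcolOf S 𝔎.carrier) (eps1Of S 𝔎.carrier) j h' U *
            (wtP 𝔎 X win j h'.proj U * Real.exp (-((towerOfAC 𝔎 X 𝔖).mainT j h'.proj U) + (towerOfAC 𝔎 X 𝔖).Pint j h'.proj U - (towerOfAC 𝔎 X 𝔖).Ecst j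
            + (towerOfAC 𝔎 X 𝔖).Zterm j h'.proj + (towerOfAC 𝔎 X 𝔖).Rm j))))
        ≤ᵐ[fieldMeasure S.P (j + 1) G] fun V => massP 𝔎 X (j + 1) h' V *
          ((win j h').indicator (fun _ => (1 : ℝ)) V * Real.exp (-((towerOfAC 𝔎 X 𝔖).mainT (j + 1) h' V) - (towerOfAC 𝔎 X 𝔖).Ecst j
              + ((piecesAC 𝔎 X 𝔖 j).logσ₀ + (piecesAC 𝔎 X 𝔖 j).dg * Real.log ((towerOfAC 𝔎 X 𝔖).g j)) * (piecesAC 𝔎 X 𝔖 j).starB h'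
              + (piecesAC 𝔎 X 𝔖 j).logZU h' V + (piecesAC 𝔎 X 𝔖 j).Pold h' V
              + (towerOfAC 𝔎 X 𝔖).Zterm j ((piecesAC 𝔎 X 𝔖 j).proj h') + (towerOfAC 𝔎 X 𝔖).Rm j + (piecesAC 𝔎 X 𝔖 j).logFl h' V)) := by
      intro h'
      filter_upwards [hrow j hj h'] with V h
      exact h.trans (le_of_eq (by ring))
    have hstep := transport41_le_sum_ae_direct (X.av_ac j) (Hist.proj (P := S.P) (k := j)) (fun U => min ((towerOfAC 𝔎 X 𝔖).ρ j U) ((fun U => ∑ h : Hist S.P j, wtP 𝔎 X win j h U * Real.exp (-((towerOfAC 𝔎 X 𝔖).mainT j h U) + (towerOfAC 𝔎 X 𝔖).Pint j h U - (towerOfAC 𝔎 X 𝔖).Ecst j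
            + (towerOfAC 𝔎 X 𝔖).Zterm j h + (towerOfAC 𝔎 X 𝔖).Rm j)) U)) hρti
      (wtP 𝔎 X win j) (fun h U => (-((towerOfAC 𝔎 X 𝔖).mainT j h U) + (towerOfAC 𝔎 X 𝔖).Pint j h U - (towerOfAC 𝔎 X 𝔖).Ecst j
            + (towerOfAC 𝔎 X 𝔖).Zterm j h + (towerOfAC 𝔎 X 𝔖).Rm j))
      (stepWeight 𝔎.carrier.M₁ (rcolOf S 𝔎.carrier) (eps1Of S 𝔎.carrier) (epsSOf S 𝔎.carrier) j)
      (chiB 𝔎.carrier.M₁ (rcolOf S 𝔎.carrier) (eps1Of S 𝔎.carrier) j)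
      (massP 𝔎 X (j + 1))
      (fun h' V => (win j h').indicator (fun _ => (1 : ℝ)) V * Real.exp (-((towerOfAC 𝔎 X 𝔖).mainT (j + 1) h' V) - (towerOfAC 𝔎 X 𝔖).Ecst j
              + ((piecesAC 𝔎 X 𝔖 j).logσ₀ + (piecesAC 𝔎 X 𝔖 j).dg * Real.log ((towerOfAC 𝔎 X 𝔖).g j)) * (piecesAC 𝔎 X 𝔖 j).starB h'
              + (piecesAC 𝔎 X 𝔖 j).logZU h' V + (piecesAC 𝔎 X 𝔖 j).Pold h' V
              + (towerOfAC 𝔎 X 𝔖).Zterm j ((piecesAC 𝔎 X 𝔖 j).proj h') + (towerOfAC 𝔎 X 𝔖).Rm j + (piecesAC 𝔎 X 𝔖 j).logFl h' V))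
      (fun U => min_le_right _ _) hintW (fun h U => (wtP_nonneg_le 𝔎 X win j h U).1)
      (measurable_stepWeight _ _ _ _ j) (stepWeight_nonneg _ _ _ _ j) (stepWeight_le_one _ _ _ _ j)
      (measurable_chiB _ _ _ j) (chiB_nonneg _ _ _ j) (chiB_le_one _ _ _ j)
      (fun h U hne => massRecP_cover _ _ _ _ _ j hLS h U (fun h0 => hne (le_antisymm
        (h0 ▸ (wtP_nonneg_le 𝔎 X win j h U).2) (wtP_nonneg_le 𝔎 X win j h U).1)))
      hdirect
    -- the honesty of the version selection: `ρ_(j+1) = T_j ρ_j = T_j (min ρ_j Maj)` a.e.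
    have hρT : ∀ᵐ V ∂(fieldMeasure S.P (j + 1) G), (towerOfAC 𝔎 X 𝔖).ρ (j + 1) V = rnTransport (X.av j).avg (fun U => min ((towerOfAC 𝔎 X 𝔖).ρ j U) ((fun U => ∑ h : Hist S.P j, wtP 𝔎 X win j h U * Real.exp (-((towerOfAC 𝔎 X 𝔖).mainT j h U) + (towerOfAC 𝔎 X 𝔖).Pint j h U - (towerOfAC 𝔎 X 𝔖).Ecst j
            + (towerOfAC 𝔎 X 𝔖).Zterm j h + (towerOfAC 𝔎 X 𝔖).Rm j)) U)) V := by
      have hW : (towerWAC 𝔎 X 𝔖).rho j =ᵐ[fieldMeasure S.P j G] (fun U => min ((towerOfAC 𝔎 X 𝔖).ρ j U) ((fun U => ∑ h : Hist S.P j, wtP 𝔎 X win j h U * Real.exp (-((towerOfAC 𝔎 X 𝔖).mainT j h U) + (towerOfAC 𝔎 X 𝔖).Pint j h U - (towerOfAC 𝔎 X 𝔖).Ecst j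
            + (towerOfAC 𝔎 X 𝔖).Zterm j h + (towerOfAC 𝔎 X 𝔖).Rm j)) U)) := by
        rw [← hpin]
        exact hρt_ae
      have hcongr : rnTransport (X.av j).avg ((towerWAC 𝔎 X 𝔖).rho j) = rnTransport (X.av j).avg (fun U => min ((towerOfAC 𝔎 X 𝔖).ρ j U) ((fun U => ∑ h : Hist S.P j, wtP 𝔎 X win j h U * Real.exp (-((towerOfAC 𝔎 X 𝔖).mainT j h U) + (towerOfAC 𝔎 X 𝔖).Pint j h U - (towerOfAC 𝔎 X 𝔖).Ecst j
            + (towerOfAC 𝔎 X 𝔖).Zterm j h + (towerOfAC 𝔎 X 𝔖).Rm j)) U)) :=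
        rnTransport_congr_ae hW (fun U => run3_rho_nonneg ((inputOfAC 𝔎 X 𝔖).toRunInput fun _ => True) j U) hρt0
      filter_upwards [run3_rho_succ_ae_eq_rn ((inputOfAC 𝔎 X 𝔖).toRunInput fun _ => True) j] with V hV
      rw [← hcongr]
      exact (congrFun ((towerWAC 𝔎 X 𝔖).pin_rho (j + 1)) V).trans hV
    -- exponent bookkeeping
    have hexp := RepAtHeightsAdapter.expo5558_le_expo41_succ
      (Summit.QuantumFields.Balaban3D.Proofs.Thm2AC.stepLeavesOfAC j hj (R j hj)) hj (gk_pos S j) (gk_le_one S S.gK_le_one j (by omega))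
    filter_upwards [hstep, hρT] with V hV hρV
    rw [hρV]
    refine hV.trans (Finset.sum_le_sum fun h' _ => ?_)
    rw [wtP_succ]
    have hM0 := massRecP_nonneg 𝔎.carrier.M₁ (rcolOf S 𝔎.carrier) (eps1Of S 𝔎.carrier) (epsSOf S 𝔎.carrier) X.av (j + 1) h' V
    have hi0 : 0 ≤ (win j h').indicator (fun _ => (1 : ℝ)) V := Set.indicator_nonneg (fun _ _ => zero_le_one) V
    have key : ∀ {m i x y : ℝ}, 0 ≤ m → 0 ≤ i → x ≤ y → m * (i * x) ≤ i * m * y := by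
      intro m i x y hm hi hxy
      calc m * (i * x) = i * m * x := by ring
        _ ≤ i * m * y := mul_le_mul_of_nonneg_left hxy (mul_nonneg hi hm)
    exact key hM0 hi0 (Real.exp_le_exp.mpr (hexp h' V))

end Summit.QuantumFields.YangMills.Theorems.PinnedStep

end
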